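import Literature.AnabelianGeometry.EtaleTheta.Discharge.Sec4Prop42SubBaseLift

/-!
# [EtTh] Prop 4.2 (iii), RESHAPED sub-node L03′ `Prop42Sub.BaseFrobeniusLiftUpToUnit` DISCHARGED at the
# canonical model, and the node `Prop42_iii` there from the covering step L01′ alone

Mochizuki, *The étale theta function …*, Publ. RIMS **45** (2009), §4, Prop. 4.2 (iii), PDF p. 89 L83 –
p. 90 L6 (printed pp. 315–316) [cite: MochizukiEtTh2009, Prop 4.2 p.89]: «since the Frobenioid `C` is of
model [hence, in particular, pre-model] type [cf. Theorem 3.7, (i)], it follows that `C` admits a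
base-Frobenius pair [cf. [FrdI], Definition 2.7, (iii)]».  abc-iut cell, layer L2,
plan/L2/SUBDAG-EtTh-Prop42.md §B, L2-lead RULING 2026-08-26T03:05Z (finding F-w4d044-1, abc-iut-w4-d044:
L03 as typed pins `α' = φ` for a GIVEN `φ` and is false at models with a non-trivial unit; RESHAPE L03 →
L03′ «up to a unit, twist case excluded», `Prop42Sub.lean` §A′).  Seat abc-iut-w5-d134 (writer of the
sub-DAG).  PROOF-ONLY companion of `Prop42Sub.lean` (v-next: `SaturatedRootCoverInSkeleton`,
`BaseFrobeniusLiftUpToUnit`, `prop42_iii_of_subnodes_upToUnit`) over `Sec4Prop42SubBaseLift.lean`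
(`exists_baseFrobeniusTypeData_of_isDistinguished`, `baseFrobeniusLift_mkOfModelCanonical_of_not_iso`) and
abc-iut-L1 vocabulary (`ModelFrobenioid.exists_isBaseFrobeniusPair_obj`, `unitAut`).

* `ModelFrobenioid.exists_mem_units_comp_eq` — two linear `Div`-free morphisms `φ, ψ : X → Y` of the model
  Frobenioid over the same base morphism differ by a unit of `X`: `ψ = s ≫ φ`, `s ∈ O^×(X)` ([FrdI] Thm.
  5.2 (ii) bookkeeping: `u_s := u_ψ · u_φ⁻¹`, `Div_B(u_s) = 0` by the two relations (d)).
* `Prop42Sub.baseFrobeniusLiftUpToUnit_mkOfModelCanonical` — **L03′ holds at abc-iut-L2-t9's canonical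
  model `mkOfModelCanonical`, `Φ` divisorial**: if `A'^bs ≇ A_⊙^bs`, the base-Frobenius pair THROUGH `φ`
  gives the data with `s = 1` (`…_of_not_iso`); if `A' = A_⊙`, any base-Frobenius pair through `A_⊙`
  ([FrdI] Prop. 5.6 «`A ∈ Ob(P)`») contains THE `P`-arrow `ψ` over `Base(φ)` (Def. 2.7 (i)(c): `P ⥲ D` is
  full), `ψ = s ≫ φ` for a unit `s`, and the generic lemma applies to `ψ`.
* `Prop42Sub.prop42_iii_mkOfModelCanonical_of_inSkeleton` — **the typed node `Prop42_iii` at the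
  canonical model (transport `pullFracModel`) follows from L01′ `SaturatedRootCoverInSkeleton` alone**,
  modulo `Φ` divisorial and the [FrdI] Prop. 4.1 (iii) law «pull-back preserves coprimality» (`hDSpull`,
  the one named input of L02 `rootFractionPair_mkOfModel`): the re-pinned composition
  `prop42_iii_of_subnodes_upToUnit` with L02, L03′, L04 all theorems at the model and the transport law
  `pullFracModel (s ≫ φ) = pullFracModel φ` (`B(Base(s ≫ φ)) = B(Base φ)` for a unit `s`).  So [EtTh]
  Prop. 4.2 (iii) AS TYPED is OPEN at the canonical model EXACTLY MODULO L01a (ERRATUM E2: tempered-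
  meromorphic roots over a covering) and L01b ([FrdII] Rmk. 2.2.1 saturation), delivered in skeleton form.
HONEST FRAMING: nothing here asserts that such data exist for an actual curve; typed ≠ proved for
Prop. 4.2 (iii) itself; no side is taken on any disputed claim.
-/

noncomputable section

namespace Literature.AlgebraicGeometry.Frobenioids

namespace ModelFrobenioid

open CategoryTheory Opposite

universe w v u

variable {D : Type u} [Category.{v} D] {Φ B : Dᵒᵖ ⥤ CommMonCat.{w}} {DivB : B ⟶ monoidGp Φ}

/-- **Parallel pull-back morphisms differ by a unit** ([FrdI] Thm. 5.2 (i)–(ii)): for linear morphisms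
`φ, ψ : X → Y` of the model Frobenioid with `Div(φ) = Div(ψ) = 0` and `Base(φ) = Base(ψ)`, there is
`s ∈ O^×(X)` with `ψ = s ≫ φ` — namely `s = (1, id, 0, u_ψ · u_φ⁻¹)`, a unit because the relations (d) of
`φ` and `ψ` give `Div_B(u_φ) = Div_B(u_ψ)` (`B` group-like). [cite: MochizukiFrdI2008, Thm. 5.2(ii) p.101] -/
theorem exists_mem_units_comp_eq (hBg : Objectwise (fun M _ => IsGroupLike M) B)
    {X Y : ModelFrobenioid Φ B DivB} (φ ψ : X ⟶ Y) (hn : degFr φ = 1) (hd : div φ = 1)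
    (hn' : degFr ψ = 1) (hd' : div ψ = 1) (hb : baseMap ψ = baseMap φ) :
    ∃ s : Aut X, s ∈ units X ∧ s.hom ≫ φ = ψ := by
  obtain ⟨wφ, hwφ⟩ := (hBg X.base).isUnit (unit φ)
  obtain ⟨wψ, hwψ⟩ := (hBg X.base).isUnit (unit ψ)
  have hrel : divB Φ B DivB _ (unit φ) = divB Φ B DivB _ (unit ψ) := by
    have h1 := rel φ
    have h2 := rel ψ
    rw [hn, hd, PNat.one_coe, pow_one, map_one, mul_one] at h1
    rw [hn', hd', PNat.one_coe, pow_one, map_one, mul_one, hb] at h2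
    exact mul_left_cancel (h1.symm.trans h2)
  have hu : Algebra.GrothendieckGroup.of (1 : Φ.obj (op X.base)) =
      divB Φ B DivB _ ((↑(wψ * wφ⁻¹) : B.obj (op X.base))) := by
    rw [map_one, Units.val_mul, map_mul, hwψ, ← hrel, ← hwφ, ← map_mul, Units.mul_inv, map_one]
  have hu' : Algebra.GrothendieckGroup.of (1 : Φ.obj (op X.base)) =
      divB Φ B DivB _ ((↑(wφ * wψ⁻¹) : B.obj (op X.base))) := by
    rw [map_one, Units.val_mul, map_mul, hwφ, hrel, ← hwψ, ← map_mul, Units.mul_inv, map_one]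
  have hinv : (↑(wφ * wψ⁻¹) : B.obj (op X.base)) * ↑(wψ * wφ⁻¹) = 1 := by
    rw [← Units.val_mul, mul_assoc, inv_mul_cancel_left, mul_inv_cancel, Units.val_one]
  let s : Aut X := unitAut X 1 1 _ _ hu hu' (mul_one 1) hinv
  have hbs : baseMap s.hom = 𝟙 _ := rfl
  have hds : div s.hom = 1 := rfl
  have hus : unit s.hom = ↑(wψ * wφ⁻¹) := rfl
  have hns : degFr s.hom = 1 := rfl
  refine ⟨s, unitAut_mem_units X 1 1 _ _ hu hu' _ _, hom_ext ?_ ?_ ?_ ?_⟩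
  · rw [degFr_comp, hn, hn', hns, mul_one]
  · rw [baseMap_comp, hbs, Category.id_comp, hb]
  · rw [div_comp_pull, hbs, pull_id, hd, hd', hn, PNat.one_coe, pow_one, hds, mul_one]
  · rw [unit_comp_pull, hbs, pull_id, hn, PNat.one_coe, pow_one, hus, ← hwφ, ← hwψ, Units.val_mul,
      mul_left_comm, Units.mul_inv, mul_one]

end ModelFrobenioid

end Literature.AlgebraicGeometry.Frobenioids

namespace Literature.AnabelianGeometry.EtaleTheta

open CategoryTheory Opposite Literature.AlgebraicGeometry.Frobenioids

universe u₀ v₀ u v w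

variable {K : Type u₀} [Field K]

namespace BiKummerSetting

section Canonical

variable (X : SemiGraphs.TemperedArithmeticGroup.{u₀} K) {D₀ : Type u₀}
  [Category.{v₀} D₀] {V : FrdIMonoidStub.{w}} {T : RealifiedDivisorMonoids (D₀ := D₀) V}
  {D : Type u} [Category.{v} D] {VD : FrdICatStub.{u, v, w} D}
  (tf : TemperedFrobenioid T D VD) (hZ : tf.monoidType = MonoidType.Z)
  (hP : ∀ A : Dᵒᵖ, IsPerfect (tf.Φ.carrier A)) (IG : D → Prop) (gS : ∀ A : D, IG A → (X.Pi →* Aut A))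
  (gSs : ∀ (A : D) (h : IG A), Function.Surjective (gS A h))
  (NH : Subgroup (Field.absoluteGaloisGroup K) → tf.category → ℕ+ → Prop) (A₀ : tf.category)
  (hA₀ : PreFrobenioid.IsFrobeniusTrivial tf.toElem A₀) (hA₀' : IG A₀.base)
  (hΦd : Objectwise (fun M _ => IsDivisorial M) tf.divisorMonoid)

include hΦd in
/-- **L03′ `BaseFrobeniusLiftUpToUnit` DISCHARGED at the canonical model** (`Φ` divisorial): for a
pull-back morphism `φ : A' → A_⊙` with `A'` Galois and `μ_N`-saturated, and `A' = A_⊙` whenever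
`A'^bs ≅ A_⊙^bs`, there are a unit `s ∈ O^×(A')`, an isometry `α : A' → A_⊙` of Frobenius degree `N` and
data of base-Frobenius type for `α` with pull-back part `s ≫ φ` — from the base-Frobenius pair of the model
Frobenioid through `φ` (genuine covering, `s = 1`), resp. through `A_⊙` and THE `P`-arrow over `Base(φ)`
(`A' = A_⊙`). [cite: MochizukiEtTh2009, Prop 4.2 p.89] -/
theorem Prop42Sub.baseFrobeniusLiftUpToUnit_mkOfModelCanonical :
    Prop42Sub.BaseFrobeniusLiftUpToUnit (mkOfModelCanonical X tf hZ hP IG gS gSs NH A₀ hA₀ hA₀') := by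
  intro N A' φ hsk hφ _ hG hμ
  have hBg := tf.isGroupLike_ratFnFunctor T.isUnit_BΛ
  by_cases hne : Nonempty (A'.base ≅ A₀.base)
  · have hAA : A₀ = A' := (hsk hne).symm
    subst hAA
    obtain ⟨P, Fr, hPF, hobj⟩ := ModelFrobenioid.exists_isBaseFrobeniusPair_obj hΦd hBg A₀
      (ModelFrobenioid.exists_cls_eq_divB_of_isFrobeniusTrivial A₀ hA₀)
    haveI := hPF.isBaseSection.isEquivalence
    let AP : P.Cat := ⟨A₀, hobj⟩
    let b : (P.toBase tf.toElem).obj AP ⟶ (P.toBase tf.toElem).obj AP := ModelFrobenioid.baseMap φ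
    let ψP : AP ⟶ AP := (P.toBase tf.toElem).preimage b
    have hψb : ModelFrobenioid.baseMap ψP.1 = ModelFrobenioid.baseMap φ := (P.toBase tf.toElem).map_preimage b
    obtain ⟨hnψ, hdψ⟩ :=
      ModelFrobenioid.degFr_div_of_isPullbackMorphism hΦd (hPF.isBaseSection.hom_pullback ψP.1 ψP.2)
    obtain ⟨hnφ, hdφ⟩ := ModelFrobenioid.degFr_div_of_isPullbackMorphism hΦd hφ
    obtain ⟨s, hs, hsφ⟩ := ModelFrobenioid.exists_mem_units_comp_eq hBg φ ψP.1 hnφ hdφ hnψ hdψ hψb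
    obtain ⟨α, d, hd, hiso, hdeg⟩ := Prop42Sub.exists_baseFrobeniusTypeData_of_isDistinguished
      (mkOfModelCanonical X tf hZ hP IG gS gSs NH A₀ hA₀ hA₀') hΦd (fun _ _ _ h => h) hPF ψP.1 ψP.2 hG N hμ
    exact ⟨s, ⟨hs.1, hs.2⟩, α, d, hd.trans hsφ.symm, hiso, hdeg⟩
  · obtain ⟨α, d, hd, hiso, hdeg⟩ := Prop42Sub.baseFrobeniusLift_mkOfModelCanonical_of_not_iso X tf hZ hP
      IG gS gSs NH A₀ hA₀ hA₀' hΦd N A' φ hφ hG hμ hne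
    refine ⟨1, (tf.units A').one_mem, α, d, ?_, hiso, hdeg⟩
    rw [hd]
    exact (Category.id_comp _).symm

include hΦd in
/-- **Prop. 4.2 (iii) AS TYPED at the canonical model from L01′ alone**: with transport `pullFracModel`
(`((α')^birat)^* = B(Base α')`), the typed node `Prop42_iii` follows from the covering step
`SaturatedRootCoverInSkeleton` (L01a ERRATUM E2 + L01b [FrdII] Rmk. 2.2.1, in skeleton form), modulo `Φ`
divisorial and the [FrdI] Prop. 4.1 (iii) coprimality-pull-back law — by the re-pinned composition
`prop42_iii_of_subnodes_upToUnit` with L02 (`rootFractionPair_mkOfModel`), L03′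
(`baseFrobeniusLiftUpToUnit_mkOfModelCanonical`) and L04 (`rootSquares_mkOfModel`) theorems at the model.
[cite: MochizukiEtTh2009, Prop 4.2 p.88] -/
theorem Prop42Sub.prop42_iii_mkOfModelCanonical_of_inSkeleton
    (hDSpull : ∀ {A A' : D} (e : A' ⟶ A) {a b : tf.Φ.carrier (op A)},
      (∀ x : tf.Φ.carrier (op A), x ∣ a → x ∣ b → x = 1) →
        ∀ y : tf.Φ.carrier (op A'), y ∣ pull tf.divisorMonoid e a → y ∣ pull tf.divisorMonoid e b → y = 1)
    (h₁ : Prop42Sub.SaturatedRootCoverInSkeleton (mkOfModelCanonical X tf hZ hP IG gS gSs NH A₀ hA₀ hA₀')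
      (fun {_ _} φ x => tf.pullFracModel φ x)) :
    (mkOfModelCanonical X tf hZ hP IG gS gSs NH A₀ hA₀ hA₀').Prop42_iii (fun {_ _} φ x => tf.pullFracModel φ x) :=
  Prop42Sub.prop42_iii_of_subnodes_upToUnit (mkOfModelCanonical X tf hZ hP IG gS gSs NH A₀ hA₀ hA₀')
    (fun φ s hs f => by
      apply Units.ext
      rw [TemperedFrobenioid.coe_pullFracModel_apply, TemperedFrobenioid.coe_pullFracModel_apply,
        ModelFrobenioid.baseMap_comp]
      have hb : ModelFrobenioid.baseMap s.hom = 𝟙 _ := hs.1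
      rw [hb, Category.id_comp])
    h₁
    (rootFractionPair_mkOfModel tf hZ hP T.isUnit_BΛ _ IG gS gSs NH _ A₀ hA₀ hA₀' hΦd
      (fun N h x hxa hxb => h x (dvd_pow hxa (PNat.ne_zero N)) (dvd_pow hxb (PNat.ne_zero N))) hDSpull)
    (Prop42Sub.baseFrobeniusLiftUpToUnit_mkOfModelCanonical X tf hZ hP IG gS gSs NH A₀ hA₀ hA₀' hΦd)
    (rootSquares_mkOfModel tf hZ hP T.isUnit_BΛ _ IG gS gSs NH _ A₀ hA₀ hA₀')

end Canonical

end BiKummerSetting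

end Literature.AnabelianGeometry.EtaleTheta

end
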